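import Summits.BirchSwinnertonDyer.Rank1Residual.Additive.X4SharpUnitFreeKimConjecture
import Literature.NumberTheory.EllipticCurves.Kim2026.ShaLengthRankZeroKuriharaDivisibilityBound
import Literature.NumberTheory.EllipticCurves.Rank1Residual.PeriodUnitProofs
import HarnessLib

/-!
# Kim's structure theorem (6) at `p ≥ 5` in the kernel: the typed predicates `X4.KimShaLengthRankZeroAt`
# and `X4.KimShaLengthAt` DISCHARGED from the two one-sided published facts, and what follows per pair —
# `BSD(E,p) ⟺ Kim's Conjecture 1.10 at (E,p)`, half by half (cell `b2b-bsdres`, seat additive-p4 gen 17,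
# line V30; CLASS-CLOSURE §3.1 N11 / §3.2 N10, item "additive-p4 (b)" of harvest-2 GEN 30 / cc-typer-1)

HONEST FRAMING (cell `b2b-bsdres`, run/shared/lean/b2b/bsd-rank1-residual/, verbatim in every
file): the goal of the cell is to DELETE the COMBINATION-SHAPED residual classes of the
Birch–Swinnerton-Dyer formula for ALL analytic-rank `≤ 1` elliptic curves over `ℚ` — "full BSD
formula for every rank `≤ 1` curve in class `C`" assembled STRICTLY from published theorems — so
that the rank-`≤ 1` remainder becomes exactly the CONSTRUCTION-SHAPED classes, which are TYPED
(missing-input `Prop`s), NOT attempted. This is not "finishing BSD". Sub-cell additive-p4 (X3♯/X4♯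
direct): research route on the CONSTRUCTION-SHAPED class X4; the label X4 and the marks of
RESIDUAL-MAP §I N10/N11 are UNCHANGED; nothing is booked by this file. Theorems only (no definition,
no named fact minted). Every published input is an explicit named-fact HYPOTHESIS of the tree:
`hKimk` = `Kim2026.rankZero_le_padicValNat_sha_of_kuriharaNumber_ne_zero` (n1011-p11, the ∃/LOWER
direction of Kim Thm. 1.8 (6), flag `Kim-(6)-partial-reading`) and `hE67c` =
`Kim2026.rankZero_padicValNat_sha_add_le_of_forall_pow_dvd_kuriharaNumber_cyclicLevel` (harvest-2
E67c, the ∀/UPPER direction over CYCLIC Kolyvagin levels, flag `Kim2026-(6)-cyclic-reading` — the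
cell referee rules which reading of Kim's `𝒩_k` is the statement of record; under the literal
reading of §1.2.2 that fact is NOT weaker than print, see its docstring). Everything below inherits
BOTH flags and is worth exactly what the referee's ruling makes the two facts worth.

## What this file proves

* §1 **`X4.kimShaLengthRankZeroAt_of_kimFacts_of_five_le`** — clause (6) in BSD currency
  (cc-typer-1's `X4.KimShaLengthRankZeroAt W p D.f`: `L(E,1)/Ω(W) = q`, `∂^{(∞)}(δ̃) = d ∈ ℕ`,
  `ord_p q = ord_p #Ш(E/ℚ)(p) + d`) at every `p ≥ 5` with `ρ̄_{E,p}` onto, `L(E,1) ≠ 0`, `Ш` finite,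
  for every modular datum `D` AT THE CONDUCTOR LEVEL (`W.conductorNorm ℤ = N`, harvest-2's
  integrality binder) with `p ∤ c_D` and the period transfer `Ω(W) = u·Ω⁺_{D.f}`, `|u|_p = 1` — ANY
  reduction type at `p`. Synthesis: UPPER at every `m ≤ ∂^{(∞)}` (harvest-2's bridge
  `Kim2026.rankZero_padicValNat_sha_add_le_of_le_kuriharaPartialInfty`), LOWER at `∂^{(∞)} ≤ τ`
  (n1011-p12's `X4.padicValRat_le_of_kuriharaPartialInfty_le` over `hKimk`); the FINITENESS of
  `∂^{(∞)}(δ̃)` is forced by the UPPER fact itself (were `∂^{(∞)} = ⊤`, every `m` would bound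
  `ord_p(L(E,1)/Ω)` from below). cc-typer-1's `X4/KimShaLength.lean` recorded "no `_of_five_le`
  theorem is claimed for the `∂`-exact shape": §1b supplies it — `X4.kimShaLengthAt_of_kimShaLengthRankZeroAt`
  (the rank-`0` CONVERSE of cc-typer-1's bridge) and **`X4.kimShaLengthAt_of_kimFacts_of_five_le`**,
  the VERBATIM CORE `length Ш[p^∞] = ∂^{(ord δ̃)}(δ̃) − ∂^{(∞)}(δ̃)` in analytic rank `0` at `p ≥ 5`.
* §2 **per pair, class-free, `p ≥ 5`**: granted GZK and modularity, in analytic rank `0` with `ρ̄`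
  onto and a conductor-level admissible datum, the two halves of the missing `p`-part output are
  EXACTLY the two halves of Kim's Conjecture 1.10 at the pair (n1011-p12's typed
  `X4.KimTamagawaDefect{Le,Ge,}At`): `Typed.MissingLowerBoundAt W p ⟺ ∂^{(∞)}(δ̃) ≤ ord_p ∏_v c_v`,
  `Typed.MissingUpperBoundAt W p ⟺ ord_p ∏_v c_v ≤ ∂^{(∞)}(δ̃)`, `Typed.MissingPPartAt W p ⟺
  BSD(E,p) ⟺ ∂^{(∞)}(δ̃) = ord_p ∏_v c_v`. So at every surjective `p ≥ 5` with a Manin datum the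
  `p`-part of BSD in analytic rank `0` IS Kim's Conjecture 1.10 at the pair, and each half of the
  conjecture is a kernel theorem exactly where the corresponding half of BSD_p already is (e.g. the
  `≤` half wherever `p ∤ #Ш_an`, the `≥` half wherever a sharp Euler-system bound is of record).
* §3 — in the SIBLING file `X4/KimShaLengthFiveLeEndState.lean` (size split): the `p ≥ 5` slice of
  gen 16's X4 ∧ `r_an = 0` end state (`x4SharpUnitFree_iff_kimTamagawaDefect_of_kimShaLength`)
  with its hypothesis (6) DISCHARGED by §1.

Nothing here closes a class: N10 ∩ X4 (p ≥ 5) stays what it was — its residue is NAMED as a printed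
conjecture per pair, with an iff; X4 stays CONSTRUCTION-SHAPED; nothing is booked; `p = 3` (N11) is
untouched by this file (there (6) is ANNOUNCED, Kim arXiv:2505.09121 Thm. 1.1, and enters gen 16's
§3 as a hypothesis).

References: C.-H. Kim, Amer. J. Math. 148 (2026) 79–129 = arXiv:2203.12159v4 [Kim2022StructureSelmer]
Thm. 1.9 (= journal 1.8) (6), Conj. 1.10 (= journal 1.9), §1.4.3–1.4.4, §1.5.1, Thm. 2.1/§2.2.3;
Miller, LMS J. Comput. Math. 14 (2011) Def. 1.1 [Miller2011LMS]; cell files CLASS-CLOSURE-PLAN.md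
§3.1/§3.2, HOME/b2b-bsdres-additive-p4/README §19–§20, INBOX 2026-08-21 05:24Z/05:35Z/05:37Z/05:40Z.
-/

noncomputable section

open scoped Classical MatrixGroups ModularForm

open CongruenceSubgroup WeierstrassCurve Literature.NumberTheory.EllipticCurves
  Literature.NumberTheory.EllipticCurves.ModularForms
  Literature.NumberTheory.EllipticCurves.Rank1Residual
  Literature.NumberTheory.EllipticCurves.Rank1Residual.Typed

namespace Summit.BirchSwinnertonDyer.Rank1Residual.X4

/-! ### §1 Clause (6) at `p ≥ 5` from the two one-sided facts -/

section SixAtFive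

variable (W : WeierstrassCurve ℚ) [W.IsElliptic] [W.IsGloballyMinimal] (p : ℕ) [Fact p.Prime]

/-- **Kim's Theorem 1.8 (6) in BSD currency at `p ≥ 5`, DISCHARGED from the two one-sided published
facts.** For `W/ℚ` globally minimal, `p ≥ 5` with `ρ̄_{E,p}` onto, `L(E,1) ≠ 0`, `Ш(E/ℚ)` finite, a
modular datum `D` at the conductor level (`W.conductorNorm ℤ = N`) with `p ∤ c_D` and the period
transfer `Ω(W) = u·Ω⁺_{D.f}`, `|u|_p = 1` — ANY reduction type at `p`: `X4.KimShaLengthRankZeroAt W p D.f`,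
i.e. `L(E,1)/Ω(W) = q ∈ ℚ`, `∂^{(∞)}(δ̃) = d ∈ ℕ` and `ord_p q = ord_p #Ш(E/ℚ)(p) + d`. UPPER from
`hE67c` at `m = d` (harvest-2's bridge), LOWER from `hKimk` at `τ = d` (n1011-p12's unwinding);
`∂^{(∞)} < ∞` because `hE67c` at every `m ≤ ⊤` would bound `ord_p q` below by every `m`. Flags of the
two facts inherited (`Kim-(6)-partial-reading`, `Kim2026-(6)-cyclic-reading`); nothing booked.
[cite: Kim2022StructureSelmer, Thm. 1.9 (6) (PDF p. 8), §1.5.1 (PDF p. 7), Thm. 2.1 and §2.2.3 (PDF p. 12)] -/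
theorem kimShaLengthRankZeroAt_of_kimFacts_of_five_le
    (hKimk : Kim2026.rankZero_le_padicValNat_sha_of_kuriharaNumber_ne_zero)
    (hE67c : Kim2026.rankZero_padicValNat_sha_add_le_of_forall_pow_dvd_kuriharaNumber_cyclicLevel)
    (hp : 5 ≤ p) (hsurj : W.HasSurjectiveModNGaloisRep p) (hL : W.entireLFunction 1 ≠ 0)
    (hfin : Finite W.sha) {N : ℕ} [NeZero N] (D : ModularParametrizationData W N)
    (hc : ¬ (p : ℤ) ∣ D.maninConstant)
    (hper : ∃ u : ℚ, ‖(u : ℚ_[p])‖ = 1 ∧ W.realPeriodRat = u * plusPeriod D.f)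
    (hN : W.conductorNorm ℤ = N) :
    KimShaLengthRankZeroAt W p D.f := by
  -- UPPER at every `m ≤ ∂^{(∞)}(δ̃)` (harvest-2's bridge over the cyclic-level fact)
  have upper : ∀ m : ℕ, (m : ℕ∞) ≤ kuriharaPartialInfty W p D.f →
      ∃ q : ℚ, W.entireLFunction 1 / (W.realPeriodRat : ℂ) = (q : ℂ) ∧
        (padicValNat p (Nat.card (AddCommGroup.primaryComponent W.sha p)) : ℤ) + m ≤
          padicValRat p q :=
    fun m hm => Kim2026.rankZero_padicValNat_sha_add_le_of_le_kuriharaPartialInfty hE67c W p hp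
      hsurj hL hfin D hc hper hN m hm
  obtain ⟨q₀, hq₀, -⟩ := upper 0 (by simp)
  have huniq : ∀ {q : ℚ}, W.entireLFunction 1 / (W.realPeriodRat : ℂ) = (q : ℂ) → q = q₀ :=
    fun hq => by exact_mod_cast hq.symm.trans hq₀
  -- `∂^{(∞)}(δ̃) < ∞`: otherwise every `m` bounds `ord_p q₀` from below
  have hfinite : kuriharaPartialInfty W p D.f ≠ ⊤ := by
    intro htop
    obtain ⟨q₁, hq₁, h1⟩ := upper ((padicValRat p q₀ -
      (padicValNat p (Nat.card (AddCommGroup.primaryComponent W.sha p)) : ℤ)).toNat + 1)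
      (by rw [htop]; exact le_top)
    rw [huniq hq₁, Nat.cast_add_one] at h1
    have h2 := Int.self_le_toNat (padicValRat p q₀ -
      (padicValNat p (Nat.card (AddCommGroup.primaryComponent W.sha p)) : ℤ))
    linarith
  obtain ⟨d, hd⟩ := ENat.ne_top_iff_exists.mp hfinite
  -- UPPER at `m = d`, LOWER at `τ = d`
  obtain ⟨q₂, hq₂, h2⟩ := upper d hd.le
  obtain ⟨q₃, hq₃, h3⟩ :=
    padicValRat_le_of_kuriharaPartialInfty_le W p hKimk hp hsurj hL hfin D hc hper (τ := d) hd.ge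
  rw [huniq hq₂] at h2
  rw [huniq hq₃] at h3
  exact ⟨q₀, d, hq₀, hd.symm, le_antisymm h3 h2⟩

/-- **The rank-`0` converse of cc-typer-1's bridge: BSD currency ⇒ the VERBATIM core.** For the
datum `D`, `p` odd, `E[p]` irreducible (so `[0]⁺_{D.f}` is `p`-integral), `L(E,1) ≠ 0` and the period
transfer: `L(E,1) = [0]⁺_{D.f}·Ω⁺_{D.f}` and `Ω(W) = u·Ω⁺_{D.f}` give `q = [0]⁺/u`, `ord_p q = ord_p [0]⁺
= ∂^{(0)}(δ̃)` (`kuriharaPartial_zero`, `kuriharaDivIndex_one_eq`), `ord(δ̃) = 0`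
(`kuriharaVanishingOrder_eq_zero_of_ratPlusSymbol_ne_zero`); so `KimShaLengthRankZeroAt W p D.f`
gives `KimShaLengthAt W p D.f` ("for every `r` with `ord(δ̃) = r`: `∂^{(∞)} = d ∈ ℕ` and
`∂^{(r)} = ord_p #Ш(p) + d`" — only `r = 0` occurs). Fact-free.
[cite: Kim2022StructureSelmer, §1.4.3–1.4.4 and §1.5.1 (PDF p. 7)] -/
theorem kimShaLengthAt_of_kimShaLengthRankZeroAt (hp2 : p ≠ 2)
    (hirr : W.HasIrreducibleModPGaloisRep p) (hL : W.entireLFunction 1 ≠ 0)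
    {N : ℕ} [NeZero N] (D : ModularParametrizationData W N)
    (hper : ∃ u : ℚ, ‖(u : ℚ_[p])‖ = 1 ∧ W.realPeriodRat = u * plusPeriod D.f)
    (h6 : KimShaLengthRankZeroAt W p D.f) : KimShaLengthAt W p D.f := by
  -- `p`-integrality and non-vanishing of `[0]⁺_f`
  have hint : ¬ p ∣ (ratPlusSymbol D.f 0).den :=
    not_dvd_den_of_norm_ratCast_le_one
      (D.isNewformOf.norm_ratPlusSymbol_le_one (x := 0) hp2 hirr (by simp))
  have hLeq := D.isNewformOf.entireLFunction_one_eq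
  have hne : ratPlusSymbol D.f 0 ≠ 0 := by
    intro h0
    apply hL
    rw [hLeq, h0]
    simp
  obtain ⟨q, d, hq, hd, hval⟩ := h6
  -- the period transfer: `q = [0]⁺_f / u`, `ord_p u = 0`
  obtain ⟨u, hu, hΩ⟩ := hper
  have hu0 : u ≠ 0 := by
    rintro rfl
    rw [Rat.cast_zero, norm_zero] at hu
    exact zero_ne_one hu
  have hΩf : 0 < plusPeriod D.f :=
    IsNewform0.plusPeriod_pos_holds D.isNewformOf.1 D.isNewformOf.coeffField_eq_bot
  have hqeq : q = ratPlusSymbol D.f 0 / u := by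
    have hu' : (u : ℂ) ≠ 0 := by exact_mod_cast hu0
    have hΩf' : ((plusPeriod D.f : ℝ) : ℂ) ≠ 0 := by exact_mod_cast hΩf.ne'
    have hC : (q : ℂ) = ((ratPlusSymbol D.f 0 / u : ℚ) : ℂ) := by
      rw [← hq, hLeq, hΩ]
      push_cast
      field_simp
    exact_mod_cast hC
  have hvq : padicValRat p (ratPlusSymbol D.f 0) = padicValRat p q := by
    rw [hqeq, padicValRat.div hne hu0, padicValRat_eq_zero_of_norm_ratCast_eq_one hu, sub_zero]
  -- `ord(δ̃) = 0`, and clause (6) at `r = 0`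
  intro r hr
  rw [kuriharaVanishingOrder_eq_zero_of_ratPlusSymbol_ne_zero W p D.f hint hne] at hr
  have hr0 : r = 0 := by exact_mod_cast hr.symm
  subst hr0
  refine ⟨d, hd, ?_⟩
  rw [kuriharaPartial_zero, kuriharaDivIndex_one_eq W p D.f hint hne, hvq, hval,
    show (padicValNat p (Nat.card (AddCommGroup.primaryComponent W.sha p)) : ℤ) + (d : ℤ) =
      ((padicValNat p (Nat.card (AddCommGroup.primaryComponent W.sha p)) + d : ℕ) : ℤ) by push_cast; rfl,
    Int.toNat_natCast]

/-- **Kim's Theorem 1.8 (6), VERBATIM CORE, at `p ≥ 5` in analytic rank `0` — a kernel theorem from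
the two one-sided published facts**: `X4.KimShaLengthAt W p D.f` ("for every `r` with `ord(δ̃) = r`,
`∂^{(∞)}(δ̃) = d ∈ ℕ` and `∂^{(r)}(δ̃) = ord_p #Ш(E/ℚ)(p) + d`", cc-typer-1's typed predicate over the
cyclic levels) for `p ≥ 5`, `ρ̄` onto, `L(E,1) ≠ 0`, `Ш` finite, a conductor-level datum with `p ∤ c_D`
and the period transfer. §1 + the converse bridge. (cc-typer-1, `X4/KimShaLength.lean`: "no
`_of_five_le` theorem is claimed for the `∂`-exact shape" — this is it, modulo the two flags.)
[cite: Kim2022StructureSelmer, Thm. 1.9 (6) (PDF p. 8), §1.5.1 (PDF p. 7), Thm. 2.1 and §2.2.3 (PDF p. 12)] -/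
theorem kimShaLengthAt_of_kimFacts_of_five_le
    (hKimk : Kim2026.rankZero_le_padicValNat_sha_of_kuriharaNumber_ne_zero)
    (hE67c : Kim2026.rankZero_padicValNat_sha_add_le_of_forall_pow_dvd_kuriharaNumber_cyclicLevel)
    (hp : 5 ≤ p) (hsurj : W.HasSurjectiveModNGaloisRep p) (hL : W.entireLFunction 1 ≠ 0)
    (hfin : Finite W.sha) {N : ℕ} [NeZero N] (D : ModularParametrizationData W N)
    (hc : ¬ (p : ℤ) ∣ D.maninConstant)
    (hper : ∃ u : ℚ, ‖(u : ℚ_[p])‖ = 1 ∧ W.realPeriodRat = u * plusPeriod D.f)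
    (hN : W.conductorNorm ℤ = N) :
    KimShaLengthAt W p D.f :=
  kimShaLengthAt_of_kimShaLengthRankZeroAt W p (by omega)
    (hasIrreducibleModPGaloisRep_of_hasSurjectiveModNGaloisRep W p hsurj) hL D hper
    (kimShaLengthRankZeroAt_of_kimFacts_of_five_le W p hKimk hE67c hp hsurj hL hfin D hc hper hN)

end SixAtFive

/-! ### §2 Per pair: the halves of the missing output ⟺ the halves of Conjecture 1.10 -/

section Halves

variable (W : WeierstrassCurve ℚ) [W.IsElliptic] [W.IsGloballyMinimal] (p : ℕ) [Fact p.Prime]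

omit [W.IsGloballyMinimal] in
/-- **`#Ш_an` and its valuation from a rank-`0` value `L(E,1)/Ω(W) = q`** (`rank E(ℚ) = 0`, `E[p]`
irreducible so `p ∤ #E(ℚ)_tors`): `#Ш_an = q·#tors²/∏_v c_v` and `ord_p #Ш_an = ord_p q − ord_p ∏_v c_v`.
Bookkeeping (the computation of cc-typer-1's `bsdp_iff_eq_tamagawa_of_rankZero_witness`).
[cite: Miller2011LMS, Def. 1.1 (arXiv:1010.2431 p. 3)] -/
theorem shaAn_of_rankZero_value (hmw : W.mordellWeilRank = W.analyticRank)
    (hL : W.entireLFunction 1 ≠ 0) (hirr : W.HasIrreducibleModPGaloisRep p) {q : ℚ}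
    (hq : W.entireLFunction 1 / (W.realPeriodRat : ℂ) = (q : ℂ)) :
    ∃ q' : ℚ, shaAn W = (q' : ℂ) ∧
      padicValRat p q' = padicValRat p q - padicValNat p W.tamagawaProduct := by
  have hr0 : W.analyticRank = 0 := analyticRank_eq_zero_of_entireLFunction_one_ne_zero hL
  have hmw0 : W.mordellWeilRank = 0 := by rw [hmw, hr0]
  have hΩpos : 0 < W.realPeriodRat := by
    haveI : (W.baseChange ℝ).IsElliptic := by rw [baseChange]; infer_instance
    exact (W.baseChange ℝ).realPeriod_pos'
  have hΩ : (W.realPeriodRat : ℂ) ≠ 0 := by exact_mod_cast hΩpos.ne'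
  rw [div_eq_iff hΩ] at hq
  have hq0 : q ≠ 0 := by
    rintro rfl
    apply hL
    rw [hq]; simp
  have ht0 : (W.torsionOrder : ℚ) ≠ 0 := by exact_mod_cast (W.torsionOrder_pos_holds).ne'
  have hc0 : (W.tamagawaProduct : ℚ) ≠ 0 := by exact_mod_cast (W.tamagawaProduct_pos').ne'
  have hsha : shaAn W = ((q * (W.torsionOrder : ℚ) ^ 2 / (W.tamagawaProduct : ℚ) : ℚ) : ℂ) := by
    have hR : W.regulator = 1 := W.regulator_eq_one_of_rank_zero hmw0
    have hc0' : (W.tamagawaProduct : ℂ) ≠ 0 := by exact_mod_cast (W.tamagawaProduct_pos').ne'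
    rw [shaAn_def, WeierstrassCurve.leadingLCoeff, hr0, iteratedDeriv_zero, Nat.factorial_zero,
      Nat.cast_one, div_one, hq, hR]
    push_cast
    field_simp
  have htors0 : padicValNat p W.torsionOrder = 0 :=
    padicValNat_torsionOrder_eq_zero_of_irreducible W p hirr
  refine ⟨_, hsha, ?_⟩
  have h2 : padicValRat p ((W.torsionOrder : ℚ) ^ 2) = 2 * padicValRat p (W.torsionOrder : ℚ) := by
    rw [pow_two, padicValRat.mul ht0 ht0]; ring
  rw [padicValRat.div (mul_ne_zero hq0 (pow_ne_zero 2 ht0)) hc0,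
    padicValRat.mul hq0 (pow_ne_zero 2 ht0), h2, padicValRat.of_nat, padicValRat.of_nat, htors0]
  push_cast; ring

omit [W.IsGloballyMinimal] in
/-- **LOWER half ⟺ `d ≤ ord_p ∏_v c_v` from a rank-`0` witness `(q, d)`** (`L(E,1)/Ω(W) = q`,
`ord_p q = ord_p #Ш(E/ℚ)(p) + d`, `Ш` finite, `E[p]` irreducible): `ord_p #Ш_an = ord_p #Ш + d − ord_p ∏c`.
Fact-free. [cite: Kim2022StructureSelmer, Thm. 1.9 (6) and Conj. 1.10 (PDF p. 8)] [cite: Miller2011LMS, Def. 1.1] -/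
theorem missingLowerBoundAt_iff_le_tamagawa_of_rankZero_witness
    (hmw : W.mordellWeilRank = W.analyticRank) (hfin : Finite W.sha)
    (hL : W.entireLFunction 1 ≠ 0) (hirr : W.HasIrreducibleModPGaloisRep p) {q : ℚ} {d : ℕ}
    (hq : W.entireLFunction 1 / (W.realPeriodRat : ℂ) = (q : ℂ))
    (hval : padicValRat p q =
      (padicValNat p (Nat.card (AddCommGroup.primaryComponent W.sha p)) : ℤ) + d) :
    MissingLowerBoundAt W p ↔ d ≤ padicValNat p W.tamagawaProduct := by
  haveI : Finite W.sha := hfin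
  obtain ⟨q', hq', hv'⟩ := shaAn_of_rankZero_value W p hmw hL hirr hq
  have hcard : (padicValNat p W.shaOrder : ℤ) =
      padicValNat p (Nat.card (AddCommGroup.primaryComponent W.sha p)) := by
    rw [WeierstrassCurve.shaOrder, padicValNat_card_addPrimaryComponent]
  constructor
  · rintro ⟨q'', hq'', hle⟩
    have hqq : q'' = q' := by exact_mod_cast hq''.symm.trans hq'
    rw [hqq, hv', hval, hcard] at hle
    have : (d : ℤ) ≤ padicValNat p W.tamagawaProduct := by linarith
    exact_mod_cast this
  · intro hd
    refine ⟨q', hq', ?_⟩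
    rw [hv', hval, hcard]
    have : (d : ℤ) ≤ padicValNat p W.tamagawaProduct := by exact_mod_cast hd
    linarith

omit [W.IsGloballyMinimal] in
/-- **UPPER half ⟺ `ord_p ∏_v c_v ≤ d` from a rank-`0` witness `(q, d)`.** Fact-free.
[cite: Kim2022StructureSelmer, Thm. 1.9 (6) and Conj. 1.10 (PDF p. 8)] [cite: Miller2011LMS, Def. 1.1] -/
theorem missingUpperBoundAt_iff_tamagawa_le_of_rankZero_witness
    (hmw : W.mordellWeilRank = W.analyticRank) (hfin : Finite W.sha)
    (hL : W.entireLFunction 1 ≠ 0) (hirr : W.HasIrreducibleModPGaloisRep p) {q : ℚ} {d : ℕ}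
    (hq : W.entireLFunction 1 / (W.realPeriodRat : ℂ) = (q : ℂ))
    (hval : padicValRat p q =
      (padicValNat p (Nat.card (AddCommGroup.primaryComponent W.sha p)) : ℤ) + d) :
    MissingUpperBoundAt W p ↔ padicValNat p W.tamagawaProduct ≤ d := by
  haveI : Finite W.sha := hfin
  obtain ⟨q', hq', hv'⟩ := shaAn_of_rankZero_value W p hmw hL hirr hq
  have hcard : (padicValNat p W.shaOrder : ℤ) =
      padicValNat p (Nat.card (AddCommGroup.primaryComponent W.sha p)) := by
    rw [WeierstrassCurve.shaOrder, padicValNat_card_addPrimaryComponent]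
  constructor
  · rintro ⟨q'', hq'', hle⟩
    have hqq : q'' = q' := by exact_mod_cast hq''.symm.trans hq'
    rw [hqq, hv', hval, hcard] at hle
    have : (padicValNat p W.tamagawaProduct : ℤ) ≤ d := by linarith
    exact_mod_cast this
  · intro hd
    refine ⟨q', hq', ?_⟩
    rw [hv', hval, hcard]
    have : (padicValNat p W.tamagawaProduct : ℤ) ≤ d := by exact_mod_cast hd
    linarith

/-- **At `p ≥ 5`, per pair, class-free: `Typed.MissingLowerBoundAt W p ⟺ X4.KimTamagawaDefectLeAt W p D.f`**
(the LOWER half of the `p`-part of BSD IS the `≤` half of Kim's Conjecture 1.10 at the pair). Analytic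
rank `0` (modularity `hmod`), GZK `hGZK`, `ρ̄_{E,p}` onto, conductor-level datum `D` with `p ∤ c_D` and
the period transfer; (6) from §1 (facts `hKimk`, `hE67c`, flags inherited). ANY reduction at `p`.
[cite: Kim2022StructureSelmer, Thm. 1.9 (6) and Conj. 1.10 (PDF p. 8)] [cite: Miller2011LMS, Def. 1.1] -/
theorem missingLowerBoundAt_iff_kimTamagawaDefectLeAt_of_kimFacts_of_five_le
    (hKimk : Kim2026.rankZero_le_padicValNat_sha_of_kuriharaNumber_ne_zero)
    (hE67c : Kim2026.rankZero_padicValNat_sha_add_le_of_forall_pow_dvd_kuriharaNumber_cyclicLevel)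
    (hGZK : rank_eq_analyticRank_of_analyticRank_le_one) (hmod : hasEntireLFunction_rat)
    (hp : 5 ≤ p) (hr : W.analyticRank = 0) (hsurj : W.HasSurjectiveModNGaloisRep p)
    {N : ℕ} [NeZero N] (D : ModularParametrizationData W N) (hN : W.conductorNorm ℤ = N)
    (hc : ¬ (p : ℤ) ∣ D.maninConstant)
    (hper : ∃ u : ℚ, ‖(u : ℚ_[p])‖ = 1 ∧ W.realPeriodRat = u * plusPeriod D.f) :
    MissingLowerBoundAt W p ↔ KimTamagawaDefectLeAt W p D.f := by
  have hL : W.entireLFunction 1 ≠ 0 := (W.analyticRank_eq_zero_iff_holds (hmod W)).mp hr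
  obtain ⟨hmw, hfin⟩ := hGZK W (by rw [hr]; exact zero_le_one)
  obtain ⟨q, d, hq, hd, hval⟩ :=
    kimShaLengthRankZeroAt_of_kimFacts_of_five_le W p hKimk hE67c hp hsurj hL hfin D hc hper hN
  rw [missingLowerBoundAt_iff_le_tamagawa_of_rankZero_witness W p hmw hfin hL
    (hasIrreducibleModPGaloisRep_of_hasSurjectiveModNGaloisRep W p hsurj) hq hval,
    KimTamagawaDefectLeAt, hd, ENat.coe_le_coe]

/-- **At `p ≥ 5`, per pair, class-free: `Typed.MissingUpperBoundAt W p ⟺ X4.KimTamagawaDefectGeAt W p D.f`**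
(the UPPER half of the `p`-part of BSD IS the `≥` half of Kim's Conjecture 1.10 at the pair — the
TAM-DEFECT₂ rows' missing input named exactly). Same hypotheses as the `≤` version.
[cite: Kim2022StructureSelmer, Thm. 1.9 (6) and Conj. 1.10 (PDF p. 8)] [cite: Miller2011LMS, Def. 1.1] -/
theorem missingUpperBoundAt_iff_kimTamagawaDefectGeAt_of_kimFacts_of_five_le
    (hKimk : Kim2026.rankZero_le_padicValNat_sha_of_kuriharaNumber_ne_zero)
    (hE67c : Kim2026.rankZero_padicValNat_sha_add_le_of_forall_pow_dvd_kuriharaNumber_cyclicLevel)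
    (hGZK : rank_eq_analyticRank_of_analyticRank_le_one) (hmod : hasEntireLFunction_rat)
    (hp : 5 ≤ p) (hr : W.analyticRank = 0) (hsurj : W.HasSurjectiveModNGaloisRep p)
    {N : ℕ} [NeZero N] (D : ModularParametrizationData W N) (hN : W.conductorNorm ℤ = N)
    (hc : ¬ (p : ℤ) ∣ D.maninConstant)
    (hper : ∃ u : ℚ, ‖(u : ℚ_[p])‖ = 1 ∧ W.realPeriodRat = u * plusPeriod D.f) :
    MissingUpperBoundAt W p ↔ KimTamagawaDefectGeAt W p D.f := by
  have hL : W.entireLFunction 1 ≠ 0 := (W.analyticRank_eq_zero_iff_holds (hmod W)).mp hr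
  obtain ⟨hmw, hfin⟩ := hGZK W (by rw [hr]; exact zero_le_one)
  obtain ⟨q, d, hq, hd, hval⟩ :=
    kimShaLengthRankZeroAt_of_kimFacts_of_five_le W p hKimk hE67c hp hsurj hL hfin D hc hper hN
  rw [missingUpperBoundAt_iff_tamagawa_le_of_rankZero_witness W p hmw hfin hL
    (hasIrreducibleModPGaloisRep_of_hasSurjectiveModNGaloisRep W p hsurj) hq hval,
    KimTamagawaDefectGeAt, hd, ENat.coe_le_coe]

/-- **At `p ≥ 5`, per pair, class-free: `Typed.MissingPPartAt W p ⟺ X4.KimTamagawaDefectAt W p D.f`**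
— the `p`-part of BSD in analytic rank `0` at a surjective `p ≥ 5` with a conductor-level Manin datum
IS Kim's Conjecture 1.10 at the pair (`∂^{(∞)}(δ̃) = ord_p ∏_v c_v`). gen 16's
`X4RankZero.missingPPartAt_iff_kimTamagawaDefectAt_of_kimShaLength` with (6) discharged by §1.
[cite: Kim2022StructureSelmer, Thm. 1.9 (6) and Conj. 1.10 (PDF p. 8)] [cite: Miller2011LMS, Def. 1.1] -/
theorem missingPPartAt_iff_kimTamagawaDefectAt_of_kimFacts_of_five_le
    (hKimk : Kim2026.rankZero_le_padicValNat_sha_of_kuriharaNumber_ne_zero)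
    (hE67c : Kim2026.rankZero_padicValNat_sha_add_le_of_forall_pow_dvd_kuriharaNumber_cyclicLevel)
    (hGZK : rank_eq_analyticRank_of_analyticRank_le_one) (hmod : hasEntireLFunction_rat)
    (hp : 5 ≤ p) (hr : W.analyticRank = 0) (hsurj : W.HasSurjectiveModNGaloisRep p)
    {N : ℕ} [NeZero N] (D : ModularParametrizationData W N) (hN : W.conductorNorm ℤ = N)
    (hc : ¬ (p : ℤ) ∣ D.maninConstant)
    (hper : ∃ u : ℚ, ‖(u : ℚ_[p])‖ = 1 ∧ W.realPeriodRat = u * plusPeriod D.f) :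
    MissingPPartAt W p ↔ KimTamagawaDefectAt W p D.f :=
  have hL : W.entireLFunction 1 ≠ 0 := (W.analyticRank_eq_zero_iff_holds (hmod W)).mp hr
  Additive.X4RankZero.missingPPartAt_iff_kimTamagawaDefectAt_of_kimShaLength W p hGZK hmod hr
    (hasIrreducibleModPGaloisRep_of_hasSurjectiveModNGaloisRep W p hsurj) D.f
    (kimShaLengthRankZeroAt_of_kimFacts_of_five_le W p hKimk hE67c hp hsurj hL (hGZK W
      (by rw [hr]; exact zero_le_one)).2 D hc hper hN)

/-- **… and in Miller's currency: `BSD(E,p) ⟺ X4.KimTamagawaDefectAt W p D.f`** at `p ≥ 5` on the same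
rows (GZK turns `MissingPPartAt` into `BSD(E,p)` and back). [cite: Kim2022StructureSelmer, Thm. 1.9 (6) and Conj. 1.10 (PDF p. 8)]
[cite: Miller2011LMS, §1 and Def. 1.1] -/
theorem bsdp_iff_kimTamagawaDefectAt_of_kimFacts_of_five_le
    (hKimk : Kim2026.rankZero_le_padicValNat_sha_of_kuriharaNumber_ne_zero)
    (hE67c : Kim2026.rankZero_padicValNat_sha_add_le_of_forall_pow_dvd_kuriharaNumber_cyclicLevel)
    (hGZK : rank_eq_analyticRank_of_analyticRank_le_one) (hmod : hasEntireLFunction_rat)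
    (hp : 5 ≤ p) (hr : W.analyticRank = 0) (hsurj : W.HasSurjectiveModNGaloisRep p)
    {N : ℕ} [NeZero N] (D : ModularParametrizationData W N) (hN : W.conductorNorm ℤ = N)
    (hc : ¬ (p : ℤ) ∣ D.maninConstant)
    (hper : ∃ u : ℚ, ‖(u : ℚ_[p])‖ = 1 ∧ W.realPeriodRat = u * plusPeriod D.f) :
    BSDp W p ↔ KimTamagawaDefectAt W p D.f := by
  have hr1 : W.analyticRank ≤ 1 := by rw [hr]; exact zero_le_one
  haveI : Finite W.sha := (hGZK W hr1).2
  rw [← missingPPartAt_iff_kimTamagawaDefectAt_of_kimFacts_of_five_le W p hKimk hE67c hGZK hmod hp hr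
    hsurj D hN hc hper]
  exact ⟨missingPPartAt_of_bsdp W p, bsdp_of_missingPPartAt W p hGZK hr1⟩

end Halves

end Summit.BirchSwinnertonDyer.Rank1Residual.X4

end
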